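import Literature.NumberTheory.LFunctions.EntireFamilyZeroSum
import Literature.NumberTheory.LFunctions.RayClassFamily
import HarnessLib

/-!
# The zero terms of the family of Hecke `L`-functions of a congruence class group, off the exceptional segment,
# with the zero-free region as a parameter

Topic `Literature/NumberTheory/LFunctions`, namespace `Literature.NumberTheory.LFunctions.AbelianDensity`.  Everything here
is PROVED (theorems only).

The ray-class counterpart of the tree's `…ClassPNTFamilyZeroSumZFR.fam_zeroSum_le_local_zfr` (class group characters):
the abstract `EntireEF.family_zeroSum_le_zfr` fed with the family `rayFamF` (`F_0 = ζ₁_K`, `F_ψ = L_ψ`) of an abelian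
Frobenius datum killing the narrow ray `mod 𝔪`, the size parameter `Q_𝔪 = |d_K| n^n N𝔪`, the window bound
`rayFam_window` and the exceptional segment `rayExcRegion c K 𝔪`.  Result (`rayFam_zeroSum_le_zfr`): given density
constants `b, D, a`, there are `ν ∈ (0,1/64]`, `a₀ ≥ 1`, `A₀ > 0` depending on `n, b, D, a` only such that for every `K`
of degree `n > 1`, every datum with `|G| ≤ Q_𝔪⁴` satisfying the density bound in `Q`-form, every `x ≥ Q_𝔪^{a₀}`,
every `c_Z > 0` for which the zeros off the segment obey `β ≤ 1 − c_Z/(a log Q_𝔪 + log(|γ|+4))`, `x^{−ν} ≤ ε ≤ 1`: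
`Σ_ψ Σ_{ρ ∈ u ψ, ¬exc} m_ψ(ρ)‖F(−ρ)‖ ≤ A₀ x (e^{−c_Z L/(4a log Q_𝔪)} + e^{−√(c_Z L/4)}) + A₀ x^{1−ν}`.

## References
* [ThornerZaman2019] J. Thorner, A. Zaman, Algebra Number Theory 13 (2019), §4.3.
* [Weiss1983] A. Weiss, J. reine angew. Math. 338 (1983), §6.
-/

noncomputable section

open Complex Real Set Filter Topology NumberField IsDedekindDomain
open scoped NumberField nonZeroDivisors

namespace Literature.NumberTheory.LFunctions.AbelianDensity

open Literature.NumberTheory.LFunctions.NumberField Literature.NumberTheory.LFunctions.EntireEF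
  Literature.NumberTheory.LFunctions.TZWeight
open scoped Classical

/-- `|Ĝ| = |G|` for a finite abelian group. [cite: Weiss1983, §6] -/
theorem card_addChar_eq_natCard (G : Type) [CommGroup G] [Finite G] :
    Fintype.card (AddChar (Additive G) ℂ) = Nat.card G := by
  letI : Fintype G := Fintype.ofFinite G
  rw [AddChar.card_eq, Nat.card_eq_fintype_card, Fintype.card_congr (Additive.toMul (α := G))]

/-- **Thorner–Zaman §4.3 for the family of a congruence class group `mod 𝔪`, zero-free region as a parameter.**
[cite: ThornerZaman2019, §4.3] [cite: Weiss1983, §6] -/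
theorem rayFam_zeroSum_le_zfr (n : ℕ) (hn : 1 < n) {b D a : ℝ} (hb : 0 < b) (hD : 0 < D) (ha : 1 ≤ a) :
    ∃ ν a₀ A₀ : ℝ, 0 < ν ∧ ν ≤ 1 / 64 ∧ 1 ≤ a₀ ∧ 0 < A₀ ∧
    ∀ (c : ℝ) (K : Type) [Field K] [NumberField K], Module.finrank ℚ K = n →
    ∀ (G : Type) [CommGroup G] [Finite G] (𝔪 : Ideal (𝓞 K)) (f : HeightOneSpectrum (𝓞 K) → G)
      (h𝔪 : 𝔪 ≠ ⊥) (hray : ArtinKillsRay 𝔪 f)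
      (hsep : ∀ χ : AddChar (Additive G) ℂ, χ ≠ 0 →
        ∃ v : HeightOneSpectrum (𝓞 K), ¬ 𝔪 ≤ v.asIdeal ∧ χ (Additive.ofMul (f v)) ≠ 1),
      (Nat.card G : ℝ) ≤ rayCondQ K 𝔪 ^ (4 : ℕ) →
      (∀ (T : ℝ), 1 ≤ T → ∀ u : AddChar (Additive G) ℂ → Finset ℂ,
        (∀ ψ, ∀ ρ ∈ u ψ, rayFamF h𝔪 hray hsep ψ ρ = 0 ∧ 1 / 4 ≤ ρ.re ∧ ρ.re < 1 ∧ |ρ.im| ≤ T) →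
        ∀ α : ℝ, α ≤ 1 →
          ∑ ψ, ∑ ρ ∈ u ψ with α ≤ ρ.re, (analyticOrderNatAt (rayFamF h𝔪 hray hsep ψ) ρ : ℝ) ≤
            D * Real.exp (b * (a * Real.log (rayCondQ K 𝔪) + Real.log (T + 4))) ^ (1 - α)) →
      ∀ x : ℝ, rayCondQ K 𝔪 ^ a₀ ≤ x → ∀ c_Z : ℝ, 0 < c_Z →
      (∀ (ψ : AddChar (Additive G) ℂ) (ρ : ℂ), rayFamF h𝔪 hray hsep ψ ρ = 0 → 1 / 4 ≤ ρ.re →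
        ρ.re < 1 → |ρ.im| ≤ x → ¬ rayExcRegion c K 𝔪 ρ →
          ρ.re ≤ 1 - c_Z / (a * Real.log (rayCondQ K 𝔪) + Real.log (|ρ.im| + 4))) →
      ∀ ε : ℝ, x ^ (-ν) ≤ ε → ε ≤ 1 →
      ∀ u : AddChar (Additive G) ℂ → Finset ℂ,
        (∀ ψ, ∀ ρ ∈ u ψ, rayFamF h𝔪 hray hsep ψ ρ = 0 ∧ 0 < ρ.re ∧ ρ.re < 1) →
        ∑ ψ, ∑ ρ ∈ u ψ with ¬ rayExcRegion c K 𝔪 ρ,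
            (analyticOrderNatAt (rayFamF h𝔪 hray hsep ψ) ρ : ℝ) * ‖fordLaplace (tzTest (Real.log x) ε) (-ρ)‖ ≤
          A₀ * x * (Real.exp (-(c_Z * Real.log x / (4 * a * Real.log (rayCondQ K 𝔪)))) +
              Real.exp (-Real.sqrt (c_Z * Real.log x / 4))) + A₀ * x ^ (1 - ν) := by
  obtain ⟨ν, a₀, A₀, hν, hν64, ha₀, hA₀, h⟩ :=
    family_zeroSum_le_zfr (512 * ((n : ℝ) + 1)) (by positivity) hb hD ha
  refine ⟨ν, a₀, A₀, hν, hν64, ha₀, hA₀,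
    fun c K _ _ hKn G _ _ 𝔪 f h𝔪 hray hsep hG hdens x hx c_Z hcZ hzfr ε hεν hε1 u hu ↦ ?_⟩
  have hK : 1 < Module.finrank ℚ K := by rw [hKn]; exact hn
  have hcard : (Fintype.card (AddChar (Additive G) ℂ) : ℝ) ≤ rayCondQ K 𝔪 ^ 4 := by
    rw [card_addChar_eq_natCard]; exact_mod_cast hG
  have hAnn : 0 ≤ Real.log (((discr K).natAbs : ℝ) * ((Ideal.absNorm 𝔪 : ℕ) : ℝ)) + 3 * Module.finrank ℚ K := by
    have := Real.log_nonneg (one_le_discr_mul_absNorm K h𝔪); positivity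
  have hwin : ∀ (ψ : AddChar (Additive G) ℂ) (τ : ℝ) (P : Finset ℂ),
      (∀ ρ ∈ P, rayFamF h𝔪 hray hsep ψ ρ = 0 ∧ 0 < ρ.re ∧ ρ.re < 1 ∧ |ρ.im - τ| ≤ 1 / 2) →
      ∑ ρ ∈ P, (analyticOrderNatAt (rayFamF h𝔪 hray hsep ψ) ρ : ℝ) ≤ (512 * ((n : ℝ) + 1)) *
        ((Real.log (((discr K).natAbs : ℝ) * ((Ideal.absNorm 𝔪 : ℕ) : ℝ)) + 3 * Module.finrank ℚ K) +
          Real.log (|τ| + 4)) := by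
    intro ψ τ P hP
    have hw := rayFam_window h𝔪 hray hsep ψ τ P hP
    rw [hKn] at hw ⊢
    exact hw
  exact h (AddChar (Additive G) ℂ) (rayFamF h𝔪 hray hsep) (differentiable_rayFamF h𝔪 hray hsep) 2
    (rayFamF_two_ne_zero h𝔪 hray hsep) (rayCondQ K 𝔪) (twelve_le_rayCondQ hK h𝔪) hcard _ hAnn
    (windowConst_le_rayCondQ h𝔪) hwin hdens (rayExcRegion c K 𝔪) x hx c_Z hcZ hzfr ε hεν hε1 u hu

end Literature.NumberTheory.LFunctions.AbelianDensity

end
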